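import Literature.NumberTheory.LFunctions.WeilSemilocalQuadratic
import Literature.NumberTheory.LFunctions.UniformWeilPositivityRH
import Mathlib.NumberTheory.Bertrand
import Mathlib.NumberTheory.PrimeCounting
import HarnessLib

/-!
# The HANDOFF window identity and the exact logical status of `RH ↔ ∀ q, H(q)` (rh-explicit, track «HANDOFF», seat prove-2)

HONEST FRAMING. Nothing here proves or approaches RH. This file pins, as theorems about the tree's own
objects (`weilQuadratic`, `weilSemilocalQuadratic`, `WeilPositivityOn`), the algebra underneath the HANDOFF
decomposition and the exact logical status of its pointwise form:

* **One-atom handoff identity** (`weilQuadratic_eq_handoff`). Let `q` be prime, `q ≤ N < q²`, and suppose no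
  prime lies in `(q, N]`. For every Weil test function `g` with `tsupport g ⊆ [−(log (N+1))/2, (log (N+1))/2]`,
  `Q(g) = Q_{S_{<q}}(g) − (log q/√q)·((g ⋆ g̃)(log q) + (g ⋆ g̃)(−log q))`,
  where `S_{<q} = Nat.primesBelow q`: on the window the full Weil form is the `{p < q}`-semilocal form minus
  the single atom `q` (the powers `q^m`, `m ≥ 2`, are invisible since `N < q²`; every other visible prime power
  is `{p < q}`-smooth). With consecutive primes `q < q'` one takes `N = q' − 1` (Bertrand: `q' ≤ 2q ≤ q²`).
* **Deficit / contribution** (`deficit`, `contribution`) and the pointwise window statement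
  `HandoffH q q'`: for every `b ∈ [(log q)/2, (log q')/2]` and every `g ∈ C(b)`,
  `deficit q g ≤ contribution q g`, i.e. `−Re Q_{S_{<q}}(g) ≤ −(log q/√q)·Re((g⋆g̃)(log q) + (g⋆g̃)(−log q))`.
* **Exact logical status** (`handoffH_iff_weilPositivityOn`, `riemannHypothesis_iff_forall_handoffH`): for
  consecutive primes `q < q'`, `HandoffH q q' ↔ WeilPositivityOn ((log q')/2)`; hence
  `RiemannHypothesis ↔ ∀ consecutive primes q < q', HandoffH q q'` with NO base clause (the window of `q = 2`
  is `[(log 2)/2, (log 3)/2]`, on which the tree already PROVES positivity, `weilPositivityOn_log_three_half`),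
  and the conjuncts are NESTED (`HandoffH` of a later pair implies every earlier one, `handoffH_anti`), not
  independent: the pointwise `H(q)` is Weil's criterion cut into windows, nothing more. Any non-tautological
  content of the track must therefore come from a SCALAR or STRUCTURAL strengthening (see the seat's
  ATTEMPT files), not from this equivalence.

References: A. Weil 1952 (criterion); E. Bombieri, Rend. Lincei (9) 11 (2000) Thm 2 (tree:
`weil_criterion_holds`, `riemannHypothesis_iff_forall_weilPositivityOn`); H. Yoshida, Adv. Stud. Pure Math. 21
(1992) §2 (2.1) (analytic form); A. Connes, Selecta Math. 5 (1999) §VII Thm 4 (semilocal Weil sum).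
-/

set_option linter.dupNamespace false

noncomputable section

open Complex Filter Set MeasureTheory Literature.NumberTheory.LFunctions
open scoped Real Topology ComplexConjugate

namespace Summit.RiemannHypothesis.RiemannHypothesis.Theorems.Handoff

variable {g : ℝ → ℂ} {q N : ℕ}

/-! ## §1 The coefficient bookkeeping: inserting the prime `q` into `S_{<q}` adds exactly the atom `q` below `q²` -/

/-- `q ∉ S_{<q}`. [folklore] -/
theorem not_mem_primesBelow_self (q : ℕ) : q ∉ Nat.primesBelow q := fun h ↦
  lt_irrefl q (Nat.lt_of_mem_primesBelow h)

/-- `S_{<q+1} = S_{≤ q}` contains `q` when `q` is prime. [folklore] -/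
theorem mem_primesBelow_succ (hq : q.Prime) : q ∈ Nat.primesBelow (q + 1) :=
  Nat.mem_primesBelow.2 ⟨Nat.lt_succ_self q, hq⟩

/-- Below `q²` the only prime power that is `{p ≤ q}`-smooth but not `{p < q}`-smooth is `q` itself:
`Λ_{S_{≤q}}(n)/√n = Λ_{S_{<q}}(n)/√n + [n = q]·(log q/√q)` for `n < q²`. [folklore] -/
theorem weilSemilocalCoeff_primesBelow_succ (hq : q.Prime) {n : ℕ} (hn : n < q ^ 2) :
    weilSemilocalCoeff (Nat.primesBelow (q + 1)) n =
      weilSemilocalCoeff (Nat.primesBelow q) n + if n = q then Real.log q / Real.sqrt q else 0 := by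
  by_cases hnq : n = q
  · subst hnq
    rw [if_pos rfl]
    unfold weilSemilocalCoeff
    rw [hq.primeFactors, if_pos (Finset.singleton_subset_iff.2 (mem_primesBelow_succ hq)),
      if_neg (fun h ↦ not_mem_primesBelow_self n (Finset.singleton_subset_iff.1 h)),
      ArithmeticFunction.vonMangoldt_apply_prime hq]
    simp
  · rw [if_neg hnq, add_zero]
    by_cases hp : IsPrimePow n
    · obtain ⟨p, m, hprime, hmpos, rfl⟩ := (isPrimePow_nat_iff n).1 hp
      have hpf : (p ^ m).primeFactors = {p} := Nat.primeFactors_prime_pow hmpos.ne' hprime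
      have hiff : (p ^ m).primeFactors ⊆ Nat.primesBelow (q + 1) ↔ (p ^ m).primeFactors ⊆ Nat.primesBelow q := by
        rw [hpf, Finset.singleton_subset_iff, Finset.singleton_subset_iff, Nat.mem_primesBelow,
          Nat.mem_primesBelow]
        constructor
        · rintro ⟨hlt, -⟩
          refine ⟨?_, hprime⟩
          rcases (Nat.lt_succ_iff.1 hlt).lt_or_eq with h | h
          · exact h
          · exfalso
            have hm2 : 2 ≤ m := by
              by_contra hm2
              have hm1 : m = 1 := by omega
              subst hm1
              exact hnq (by rw [pow_one, h])
            have hle : q ^ 2 ≤ p ^ m := by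
              rw [← h]
              exact Nat.pow_le_pow_right hprime.pos hm2
            exact absurd hn (not_lt.2 hle)
        · rintro ⟨hlt, -⟩
          exact ⟨hlt.trans (Nat.lt_succ_self q), hprime⟩
      unfold weilSemilocalCoeff
      by_cases h1 : (p ^ m).primeFactors ⊆ Nat.primesBelow (q + 1)
      · rw [if_pos h1, if_pos (hiff.1 h1)]
      · rw [if_neg h1, if_neg (fun h ↦ h1 (hiff.2 h))]
    · rw [weilSemilocalCoeff_of_not_isPrimePow _ hp, weilSemilocalCoeff_of_not_isPrimePow _ hp]

/-- The ripple bookkeeping: for `q ≤ N < q²`,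
`ρ_{S_{≤q},N}(t) = ρ_{S_{<q},N}(t) + (log q/√q)·2cos(t log q)`. [folklore] -/
theorem weilSemilocalRipple_primesBelow_succ (hq : q.Prime) (hqN : q ≤ N) (hN : N < q ^ 2) (t : ℝ) :
    weilSemilocalRipple (Nat.primesBelow (q + 1)) N t =
      weilSemilocalRipple (Nat.primesBelow q) N t + Real.log q / Real.sqrt q * (2 * Real.cos (t * Real.log q)) := by
  unfold weilSemilocalRipple
  have hmem : q ∈ Finset.range (N + 1) := Finset.mem_range.2 (Nat.lt_succ_of_le hqN)
  have e : ∀ n ∈ Finset.range (N + 1),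
      weilSemilocalCoeff (Nat.primesBelow (q + 1)) n * (2 * Real.cos (t * Real.log n)) =
        weilSemilocalCoeff (Nat.primesBelow q) n * (2 * Real.cos (t * Real.log n)) +
          (if n = q then Real.log q / Real.sqrt q * (2 * Real.cos (t * Real.log q)) else 0) := by
    intro n hn
    have hn' : n < q ^ 2 := lt_of_le_of_lt (Nat.lt_succ_iff.1 (Finset.mem_range.1 hn)) hN
    rw [weilSemilocalCoeff_primesBelow_succ hq hn', add_mul]
    congr 1
    split_ifs with h
    · subst h; rfl
    · simp
  rw [Finset.sum_congr rfl e, Finset.sum_add_distrib, Finset.sum_ite_eq' (Finset.range (N + 1)) q, if_pos hmem]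

/-- The weight bookkeeping: `w_{S_{≤q},N} = w_{S_{<q},N} − (log q/√q)·2cos(t log q)` for `q ≤ N < q²`. [folklore] -/
theorem weilSemilocalWeight_primesBelow_succ (hq : q.Prime) (hqN : q ≤ N) (hN : N < q ^ 2) (t : ℝ) :
    weilSemilocalWeight (Nat.primesBelow (q + 1)) N t =
      weilSemilocalWeight (Nat.primesBelow q) N t - Real.log q / Real.sqrt q * (2 * Real.cos (t * Real.log q)) := by
  unfold weilSemilocalWeight
  rw [weilSemilocalRipple_primesBelow_succ hq hqN hN]
  ring

/-- The analytic-form bookkeeping: for a Weil test function `g` and `q ≤ N < q²`,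
`E_{S_{≤q},N}(g) = E_{S_{<q},N}(g) − (log q/√q)·(1/2π)∫|ĝ(1/2+it)|² 2cos(t log q) dt`.
[cite: Yoshida1992, §2 eq. (2.1), the p^m-terms (one atom moved across)] -/
theorem weilSemilocalAnalytic_primesBelow_succ (hg : IsWeilTest g) (hq : q.Prime) (hqN : q ≤ N)
    (hN : N < q ^ 2) :
    weilSemilocalAnalytic (Nat.primesBelow (q + 1)) N g =
      weilSemilocalAnalytic (Nat.primesBelow q) N g -
        Real.log q / Real.sqrt q *
          (1 / (2 * π) * ∫ t : ℝ, ‖weilMellin g (1 / 2 + t * I)‖ ^ 2 * (2 * Real.cos (t * Real.log q))) := by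
  unfold weilSemilocalAnalytic
  have e : (fun t : ℝ ↦ ‖weilMellin g (1 / 2 + t * I)‖ ^ 2 * weilSemilocalWeight (Nat.primesBelow (q + 1)) N t) =
      fun t : ℝ ↦ ‖weilMellin g (1 / 2 + t * I)‖ ^ 2 * weilSemilocalWeight (Nat.primesBelow q) N t -
        Real.log q / Real.sqrt q * (‖weilMellin g (1 / 2 + t * I)‖ ^ 2 * (2 * Real.cos (t * Real.log q))) := by
    funext t
    rw [weilSemilocalWeight_primesBelow_succ hq hqN hN]
    ring
  rw [e, integral_sub (integrable_norm_sq_weilMellin_mul_weilSemilocalWeight hg _ N)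
      ((integrable_norm_sq_weilMellin_mul_two_cos hg (Real.log q)).const_mul _), integral_const_mul]
  ring

/-! ## §2 The one-atom handoff identity on the window -/

/-- **Inserting the atom `q`**: for `q` prime, `q ≤ N < q²`, and `tsupport g ⊆ [−(log (N+1))/2, (log (N+1))/2]`,
`Q_{S_{≤q}}(g) = Q_{S_{<q}}(g) − (log q/√q)·((g ⋆ g̃)(log q) + (g ⋆ g̃)(−log q))`.
[cite: Connes1999, §VII Thm 4 (the v = q term of the S-local Weil sum, m = 1 only below q²)] -/
theorem weilSemilocalQuadratic_primesBelow_succ (hg : IsWeilTest g) (hq : q.Prime) (hqN : q ≤ N) (hN : N < q ^ 2)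
    (hsupp : tsupport g ⊆ Icc (-(Real.log ((N : ℝ) + 1) / 2)) (Real.log ((N : ℝ) + 1) / 2)) :
    weilSemilocalQuadratic (Nat.primesBelow (q + 1)) g =
      weilSemilocalQuadratic (Nat.primesBelow q) g -
        (Real.log q / Real.sqrt q : ℝ) *
          (weilConv g (weilReflect g) (Real.log q) + weilConv g (weilReflect g) (-Real.log q)) := by
  rw [weilSemilocalQuadratic_eq_weilSemilocalAnalytic hg _ N hsupp,
    weilSemilocalQuadratic_eq_weilSemilocalAnalytic hg _ N hsupp,
    weilSemilocalAnalytic_primesBelow_succ hg hq hqN hN, weilConv_weilReflect_add_eq_integral hg (Real.log q)]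
  push_cast
  ring

/-- If no prime lies in `(q, N]`, every prime power `≤ N` is `{p ≤ q}`-smooth, so on `C((log (N+1))/2)` the
`S_{≤q}`-form IS Weil's form. [folklore] -/
theorem primeFactors_subset_primesBelow_succ_of_gap (hgap : ∀ p : ℕ, p.Prime → p ≤ N → p ≤ q) :
    ∀ n ≤ N, IsPrimePow n → n.primeFactors ⊆ Nat.primesBelow (q + 1) := by
  intro n hn _ p hp
  have hp' : p.Prime := Nat.prime_of_mem_primeFactors hp
  have hpn : p ≤ n := Nat.le_of_mem_primeFactors hp
  exact Nat.mem_primesBelow.2 ⟨Nat.lt_succ_of_le (hgap p hp' (hpn.trans hn)), hp'⟩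

/-- **The one-atom HANDOFF identity.** Let `q` be prime, `q ≤ N < q²`, with no prime in `(q, N]`. For every Weil
test function `g` supported in `[−(log (N+1))/2, (log (N+1))/2]`,
`Q(g) = Q_{S_{<q}}(g) − (log q/√q)·((g ⋆ g̃)(log q) + (g ⋆ g̃)(−log q))`:
on this window the full Weil form is the `{p < q}`-semilocal form minus the single atom `q`.
[cite: Connes1999, §VII Thm 4; Yoshida1992 §2 eq. (2.1)] -/
theorem weilQuadratic_eq_handoff (hg : IsWeilTest g) (hq : q.Prime) (hqN : q ≤ N) (hN : N < q ^ 2)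
    (hgap : ∀ p : ℕ, p.Prime → p ≤ N → p ≤ q)
    (hsupp : tsupport g ⊆ Icc (-(Real.log ((N : ℝ) + 1) / 2)) (Real.log ((N : ℝ) + 1) / 2)) :
    weilQuadratic g =
      weilSemilocalQuadratic (Nat.primesBelow q) g -
        (Real.log q / Real.sqrt q : ℝ) *
          (weilConv g (weilReflect g) (Real.log q) + weilConv g (weilReflect g) (-Real.log q)) := by
  rw [← weilSemilocalQuadratic_eq_weilQuadratic_of_forall hg (primeFactors_subset_primesBelow_succ_of_gap hgap) hsupp]
  exact weilSemilocalQuadratic_primesBelow_succ hg hq hqN hN hsupp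

/-! ## §3 Consecutive primes: the window `[(log q)/2, (log q')/2]` -/

/-- `q < q'` are CONSECUTIVE primes: both prime and no prime strictly between. [folklore] -/
def ConsecutivePrimes (q q' : ℕ) : Prop :=
  q.Prime ∧ q'.Prime ∧ q < q' ∧ ∀ p : ℕ, p.Prime → q < p → q' ≤ p

/-- Bertrand for consecutive primes: `q' ≤ 2q`. [folklore] -/
theorem ConsecutivePrimes.le_two_mul {q q' : ℕ} (h : ConsecutivePrimes q q') : q' ≤ 2 * q := by
  obtain ⟨p, hp, hqp, hp2⟩ := Nat.exists_prime_lt_and_le_two_mul q h.1.ne_zero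
  exact (h.2.2.2 p hp hqp).trans hp2

/-- Hence the window never reaches `q²`: `q' − 1 < q²`. [folklore] -/
theorem ConsecutivePrimes.pred_lt_sq {q q' : ℕ} (h : ConsecutivePrimes q q') : q' - 1 < q ^ 2 := by
  have h2 : 2 ≤ q := h.1.two_le
  have hle : q' ≤ 2 * q := h.le_two_mul
  have hpos : 0 < q' := h.2.1.pos
  have : 2 * q ≤ q ^ 2 := by nlinarith
  omega

/-- No prime lies in `(q, q' − 1]`. [folklore] -/
theorem ConsecutivePrimes.gap {q q' : ℕ} (h : ConsecutivePrimes q q') : ∀ p : ℕ, p.Prime → p ≤ q' - 1 → p ≤ q := by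
  intro p hp hple
  by_contra hlt
  have := h.2.2.2 p hp (not_le.1 hlt)
  omega

/-- `((q' − 1 : ℕ) : ℝ) + 1 = q'`. [folklore] -/
theorem ConsecutivePrimes.cast_pred_add_one {q q' : ℕ} (h : ConsecutivePrimes q q') :
    (((q' - 1 : ℕ) : ℝ) + 1) = (q' : ℝ) := by
  have hpos : 1 ≤ q' := h.2.1.pos
  rw [Nat.cast_sub hpos]
  push_cast
  ring

/-- **The HANDOFF identity on the window of consecutive primes `q < q'`**: for every Weil test function
supported in `[−(log q')/2, (log q')/2]`,
`Q(g) = Q_{S_{<q}}(g) − (log q/√q)·((g ⋆ g̃)(log q) + (g ⋆ g̃)(−log q))`. [cite: Connes1999, §VII Thm 4; Yoshida1992 §2 eq. (2.1)] -/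
theorem weilQuadratic_eq_handoff_of_consecutive {q q' : ℕ} (h : ConsecutivePrimes q q') (hg : IsWeilTest g)
    (hsupp : tsupport g ⊆ Icc (-(Real.log q' / 2)) (Real.log q' / 2)) :
    weilQuadratic g =
      weilSemilocalQuadratic (Nat.primesBelow q) g -
        (Real.log q / Real.sqrt q : ℝ) *
          (weilConv g (weilReflect g) (Real.log q) + weilConv g (weilReflect g) (-Real.log q)) := by
  have hqN : q ≤ q' - 1 := Nat.le_sub_one_of_lt h.2.2.1
  have hsupp' : tsupport g ⊆ Icc (-(Real.log (((q' - 1 : ℕ) : ℝ) + 1) / 2)) (Real.log (((q' - 1 : ℕ) : ℝ) + 1) / 2) := by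
    rwa [h.cast_pred_add_one]
  exact weilQuadratic_eq_handoff hg h.1 hqN h.pred_lt_sq h.gap hsupp'

/-! ## §4 Deficit, contribution, `H(q)`, and the exact logical status -/

/-- The **deficit** of the `{p < q}`-semilocal form at `g`: `−Re Q_{S_{<q}}(g)` (positive iff the semilocal form is
negative at `g`). [this track, HANDOFF README; object = Connes1999 §VII Thm 4 with S = {p < q}] -/
def deficit (q : ℕ) (g : ℝ → ℂ) : ℝ :=
  -(weilSemilocalQuadratic (Nat.primesBelow q) g).re

/-- The **contribution** of the atom `q` at `g`: `−(log q/√q)·Re((g ⋆ g̃)(log q) + (g ⋆ g̃)(−log q))`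
(what inserting the prime `q` adds to the form on a window below `log q`, i.e. before `q²` is visible).
[this track, HANDOFF README; object = the v = q, m = 1 term of Weil's prime sum] -/
def contribution (q : ℕ) (g : ℝ → ℂ) : ℝ :=
  -(Real.log q / Real.sqrt q *
    (weilConv g (weilReflect g) (Real.log q) + weilConv g (weilReflect g) (-Real.log q)).re)

/-- On the window the full form is `contribution − deficit`. [cite: Connes1999, §VII Thm 4; Yoshida1992 §2 eq. (2.1)] -/
theorem re_weilQuadratic_eq_contribution_sub_deficit {q q' : ℕ} (h : ConsecutivePrimes q q')
    (hg : IsWeilTest g) (hsupp : tsupport g ⊆ Icc (-(Real.log q' / 2)) (Real.log q' / 2)) :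
    (weilQuadratic g).re = contribution q g - deficit q g := by
  rw [weilQuadratic_eq_handoff_of_consecutive h hg hsupp]
  unfold contribution deficit
  rw [Complex.sub_re, Complex.re_ofReal_mul]
  ring

/-- **`H(q)`, pointwise form** (the HANDOFF window statement for the consecutive primes `q < q'`): for every
half-width `b ∈ [(log q)/2, (log q')/2]` and every Weil test function `g` supported in `[−b, b]`, the deficit
of the `{p < q}`-form at `g` is at most the contribution of `q` at `g`. [this track, HANDOFF README] -/
def HandoffH (q q' : ℕ) : Prop :=
  ∀ b ∈ Icc (Real.log q / 2) (Real.log q' / 2), ∀ g : ℝ → ℂ, IsWeilTest g → tsupport g ⊆ Icc (-b) b →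
    deficit q g ≤ contribution q g

/-- **Exact logical status of the pointwise `H(q)`**: for consecutive primes `q < q'`, `H(q)` is literally Weil
positivity on the cone `C((log q')/2)`. [cite: Bombieri2000Weil, §4 (windows); this track] -/
theorem handoffH_iff_weilPositivityOn {q q' : ℕ} (h : ConsecutivePrimes q q') :
    HandoffH q q' ↔ WeilPositivityOn (Real.log q' / 2) := by
  have hqq' : Real.log q / 2 ≤ Real.log q' / 2 := by
    have : (q : ℝ) ≤ q' := by exact_mod_cast h.2.2.1.le
    have hq : (0 : ℝ) < q := by exact_mod_cast h.1.pos
    linarith [Real.log_le_log hq this]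
  constructor
  · intro H g hg hsupp
    have := H (Real.log q' / 2) ⟨hqq', le_rfl⟩ g hg hsupp
    rw [re_weilQuadratic_eq_contribution_sub_deficit h hg hsupp]
    linarith
  · intro hW b hb g hg hsupp
    have hsupp' : tsupport g ⊆ Icc (-(Real.log q' / 2)) (Real.log q' / 2) :=
      hsupp.trans (Icc_subset_Icc (neg_le_neg hb.2) hb.2)
    have h0 := hW g hg hsupp'
    rw [re_weilQuadratic_eq_contribution_sub_deficit h hg hsupp'] at h0
    linarith

/-- The conjuncts are NESTED, not independent: `H` of a later pair of consecutive primes implies `H` of every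
earlier pair. [this track] -/
theorem handoffH_anti {q q' r r' : ℕ} (hq : ConsecutivePrimes q q') (hr : ConsecutivePrimes r r') (hle : q' ≤ r') :
    HandoffH r r' → HandoffH q q' := by
  rw [handoffH_iff_weilPositivityOn hq, handoffH_iff_weilPositivityOn hr]
  refine WeilPositivityOn.mono ?_
  have : (q' : ℝ) ≤ r' := by exact_mod_cast hle
  have hq' : (0 : ℝ) < q' := by exact_mod_cast hq.2.1.pos
  linarith [Real.log_le_log hq' this]

/-- `H(2)`: the window `[(log 2)/2, (log 3)/2]` is PROVED in the tree (`weilPositivityOn_log_three_half`). [tree theorem] -/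
theorem handoffH_two_three : HandoffH 2 3 := by
  have h : ConsecutivePrimes 2 3 := ⟨Nat.prime_two, Nat.prime_three, by norm_num, fun p hp h2 ↦ by omega⟩
  rw [handoffH_iff_weilPositivityOn h]
  exact_mod_cast weilPositivityOn_log_three_half

/-- Every prime `q' ≥ 3` has a predecessor: consecutive primes `q < q'`. [folklore] -/
theorem exists_consecutivePrimes_of_prime {q' : ℕ} (hq' : q'.Prime) (h3 : 3 ≤ q') : ∃ q, ConsecutivePrimes q q' := by
  have hne : (Nat.primesBelow q').Nonempty := ⟨2, Nat.mem_primesBelow.2 ⟨by omega, Nat.prime_two⟩⟩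
  refine ⟨(Nat.primesBelow q').max' hne, ?_, hq', ?_, ?_⟩
  · exact Nat.prime_of_mem_primesBelow (Finset.max'_mem _ hne)
  · exact Nat.lt_of_mem_primesBelow (Finset.max'_mem _ hne)
  · intro p hp hqp
    by_contra hlt
    have hmem : p ∈ Nat.primesBelow q' := Nat.mem_primesBelow.2 ⟨not_le.1 hlt, hp⟩
    exact absurd (Finset.le_max' _ p hmem) (not_le.2 hqp)

/-- **`RH ↔ ∀ consecutive primes q < q', H(q)`** — with no base clause and nested conjuncts: the pointwise
HANDOFF decomposition is exactly Weil's criterion (tree: `riemannHypothesis_iff_forall_weilPositivityOn`,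
Bombieri 2000 Thm 2) cut into the windows `[(log q)/2, (log q')/2]`. [cite: Bombieri2000Weil, Thm 2 and §4] -/
theorem riemannHypothesis_iff_forall_handoffH :
    RiemannHypothesis ↔ ∀ q q' : ℕ, ConsecutivePrimes q q' → HandoffH q q' := by
  rw [riemannHypothesis_iff_forall_weilPositivityOn]
  constructor
  · intro hW q q' h
    rw [handoffH_iff_weilPositivityOn h]
    have : (1 : ℝ) < q' := by exact_mod_cast h.2.1.one_lt
    exact hW _ (by have := Real.log_pos this; positivity)
  · intro H a ha
    -- a prime q' with (log q')/2 ≥ a, and its predecessor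
    obtain ⟨q', hle, hq'⟩ := Nat.exists_infinite_primes (⌈Real.exp (2 * a)⌉₊ + 3)
    have h3 : 3 ≤ q' := le_trans (Nat.le_add_left 3 _) hle
    obtain ⟨q, hcons⟩ := exists_consecutivePrimes_of_prime hq' h3
    have hW : WeilPositivityOn (Real.log q' / 2) := (handoffH_iff_weilPositivityOn hcons).1 (H q q' hcons)
    refine hW.mono ?_
    have hexp : Real.exp (2 * a) ≤ q' := by
      have h1 : Real.exp (2 * a) ≤ ⌈Real.exp (2 * a)⌉₊ := Nat.le_ceil _
      have h2 : ((⌈Real.exp (2 * a)⌉₊ : ℕ) : ℝ) ≤ q' := by exact_mod_cast le_trans (Nat.le_add_right _ 3) hle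
      exact h1.trans h2
    have hlog : 2 * a ≤ Real.log q' := by
      rw [← Real.log_exp (2 * a)]
      exact Real.log_le_log (Real.exp_pos _) hexp
    linarith

end Summit.RiemannHypothesis.RiemannHypothesis.Theorems.Handoff
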